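import Mathlib
import HarnessLib
import Literature.Analysis.FluidPDE.SelfSimilar
import Literature.Analysis.FluidPDE.KochTataru
import Literature.Analysis.FluidPDE.KochTataruKernel
import Literature.Analysis.FluidPDE.KochTataruPointwise
import Literature.Analysis.FluidPDE.NSBoundedMildOseen
import Literature.Analysis.FluidPDE.NSBoundedMildOseenDuhamel
import Literature.Analysis.FluidPDE.NSBoundedMildOseenRestart
import Literature.Analysis.FluidPDE.KNSSMildDecayHorizontal
import Literature.Analysis.UnboundedOperators.HeatKernel
import Literature.Analysis.UnboundedOperators.HeatExtensionDecay
import Summits.NavierStokesRegularity.NavierStokesRegularity.Theorems.PoloidalWindowDoorPoloidalWindowRigidityFluxTransport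
import Summits.NavierStokesRegularity.NavierStokesRegularity.Theorems.PoloidalWindowDoorPoloidalWindowRigidityZeroModeRadial
import Summits.NavierStokesRegularity.NavierStokesRegularity.Theorems.PoloidalWindowDoorPoloidalWindowRigidityZeroModeBoxKernel
import Summits.NavierStokesRegularity.NavierStokesRegularity.Theorems.PoloidalWindowDoorPoloidalWindowRigidityZeroModeBoxes

/-!
# Route `PoloidalWindowDoor`, crux `PoloidalWindowRigidity` (stmt-NavierStokesRegularity-19708) — LINE 16 «zero_mode» (ns-idea-8 g8, v1.1), stub Z-oseen
# `stub_zeroModeOseen`: THE BOX INTEGRALS OF `v₂(t)` EXCEED THOSE OF THE FREE EVOLUTION FROM TIME `s` BY AT MOST `ε|Q|` ON LARGE FLAT BOXES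

Cell ns-regularity-ideate, seat ns-poloidal-K2-p2 g13 (K2 hand).  Statement = the body of `ZeroModeOseen` (`Cruxes/PoloidalWindowRigidity/Lines/zero_mode.lean`
v1.1) VERBATIM, with the Cruxes-local `flatBox R H` unfolded to `{x | |x 0| ≤ R ∧ |x 1| ≤ R ∧ 0 ≤ x 2 ∧ x 2 ≤ H}` (as in the landed stubs F / Z-heat):
for fixed `s < t < 0` and `ε > 0` there is `L₀ > 0` with `|∫_{Q_{R,H}} v₂(t)| ≤ |∫_{Q_{R,H}} (e^{(t−s)Δ}v(s))₂| + ε·4R²H` for all `R, H ≥ L₀`.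

PROOF (pressure-free, from the mild identity alone).  By the mild identity the excess is the box integral of the Oseen–Duhamel term
`T_B = ∫_{x∈Q} (B_s(v,v)(t)(x))₂ dx`.  (Z) FUBINI: `T_B = ∫_{(τ,y)∈(s,t)×E3} ∫_{x∈Q} (K(t−τ, x−y)[v(τ,y), v(τ,y)])₂ dx` — the tree's tested Fubini identity
`Literature.Analysis.FluidPDE.integral_inner_oseenDuhamel_eq_setIntegral` adapted to the integrable test field `1_Q e₂` (`integral_inner_oseenDuhamel_eq_setIntegral_of_integrable`).
(B) THREE REGIONS (`…ZeroModeBoxKernel.lintegral_enorm_setIntegral_oseenKernel_le`, with the boxes of `…ZeroModeBoxes`: `Q_in` = `Q` shrunk by `r`, `Q_core` = by `2r`):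
`∫_y ‖∫_{x∈Q} K(t−τ,x−y)[v,v] dx‖ dy ≤ C₀M²M₀(32R²H/r + 16 r R(R+H)(t−τ)^{-1/2})`, `M = C/√(−t)` the Type-I bound on `(s,t)`.  (T) TIME: `∫_s^t` gives
`|T_B| ≤ C₀M²M₀(32R²H(t−s)/r + 32 r R(R+H)√(t−s))`; with `A = C₀M²M₀`, `r = 32(A+1)(t−s)/ε` and `L₀ = 4r + 64(A+1)r√(t−s)/ε` both terms are `≤ εR²H` once
`R, H ≥ L₀`.  The key input is the VANISHING whole-space integral of the kernel (oddness, `Literature.Analysis.FluidPDE.integral_oseenKernel_eq_zero`, KNSSRemark61):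
the box integral only sees a boundary layer of width `r` plus the kernel tail `4M₀/r`.

WHAT THIS IS NOT: with Z-heat (p681062) and F (p680813) this closes cell C1 «no hot plane» of hot_split on the line's kernel, NOT HL3′ (C2a, C2b open), NOT the crux;
19708 / 20428 / ⟨27893⟩ OPEN; no claim about Navier–Stokes regularity.
-/

noncomputable section

-- the summit and its single sub-problem share the name (CONVENTIONS §1), as in every Theorems file
set_option linter.dupNamespace false

namespace Summit.NavierStokesRegularity.NavierStokesRegularity.Theorems.PoloidalWindowDoorPoloidalWindowRigidityZeroModeOseen

open MeasureTheory Set Function Filter Topology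
open scoped RealInnerProductSpace ENNReal
open Literature.Analysis Literature.Analysis.FluidPDE Literature.Analysis.UnboundedOperators
open Summit.NavierStokesRegularity.NavierStokesRegularity.Theorems.PoloidalWindowDoorPoloidalWindowRigidityFluxTransport
open Summit.NavierStokesRegularity.NavierStokesRegularity.Theorems.PoloidalWindowDoorPoloidalWindowRigidityZeroModeRadial
open Summit.NavierStokesRegularity.NavierStokesRegularity.Theorems.PoloidalWindowDoorPoloidalWindowRigidityZeroModeBoxKernel
open Summit.NavierStokesRegularity.NavierStokesRegularity.Theorems.PoloidalWindowDoorPoloidalWindowRigidityZeroModeBoxes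

/-! ## Fubini: the Duhamel term of bounded fields against an integrable test field -/

/-- **The Duhamel term of bounded fields against an INTEGRABLE test field is the space–time integral of the tested kernel** — the tree's
`Literature.Analysis.FluidPDE.integral_inner_oseenDuhamel_eq_setIntegral` (continuous compactly supported `w`) verbatim with `w` merely integrable
(its proof uses only `∫‖w‖ < ∞` and measurability): `∫ ⟪B^ν_s(u,v)(t), w⟫ = ∫_{(s,t)×E3} (∫ ⟪K(ν(t−τ), x−y)[u(τ,y), v(τ,y)], w(x)⟫ dx) d(τ,y)`.
Adapted from `Literature/Analysis/FluidPDE/NSBoundedMildOseenDuhamel.lean`. [folklore] -/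
theorem integral_inner_oseenDuhamel_eq_setIntegral_of_integrable {ν s T M : ℝ}
    {u v : ℝ → EuclideanSpace ℝ (Fin 3) → EuclideanSpace ℝ (Fin 3)} (hν : 0 < ν)
    (hu : AEStronglyMeasurable (uncurry u) ((volume : Measure (ℝ × EuclideanSpace ℝ (Fin 3))).restrict (Ioo s T ×ˢ univ)))
    (hv : AEStronglyMeasurable (uncurry v) ((volume : Measure (ℝ × EuclideanSpace ℝ (Fin 3))).restrict (Ioo s T ×ˢ univ)))
    (hM : 0 ≤ M) (huM : ∀ τ ∈ Ioo s T, ∀ y, ‖u τ y‖ ≤ M) (hvM : ∀ τ ∈ Ioo s T, ∀ y, ‖v τ y‖ ≤ M)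
    {t : ℝ} (hst : s < t) (htT : t ≤ T) {w : EuclideanSpace ℝ (Fin 3) → EuclideanSpace ℝ (Fin 3)} (hw : Integrable w) :
    Integrable (uncurry fun (x : EuclideanSpace ℝ (Fin 3)) (p : ℝ × EuclideanSpace ℝ (Fin 3)) =>
        ⟪oseenKernel (ν * (t - p.1)) (x - p.2) (u p.1 p.2) (v p.1 p.2), w x⟫)
        ((volume : Measure (EuclideanSpace ℝ (Fin 3))).prod
          ((volume : Measure (ℝ × EuclideanSpace ℝ (Fin 3))).restrict (Ioo s t ×ˢ univ))) ∧
      ∫ x, ⟪oseenDuhamel ν s u v t x, w x⟫ =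
        ∫ p in Ioo s t ×ˢ univ,
          (∫ x, ⟪oseenKernel (ν * (t - p.1)) (x - p.2) (u p.1 p.2) (v p.1 p.2), w x⟫)
          ∂(volume : Measure (ℝ × EuclideanSpace ℝ (Fin 3))) := by
  set μ : Measure (ℝ × EuclideanSpace ℝ (Fin 3)) :=
    (volume : Measure (ℝ × EuclideanSpace ℝ (Fin 3))).restrict (Ioo s t ×ˢ univ) with hμ
  set F : EuclideanSpace ℝ (Fin 3) → ℝ × EuclideanSpace ℝ (Fin 3) → EuclideanSpace ℝ (Fin 3) := fun x p =>
    oseenKernel (ν * (t - p.1)) (x - p.2) (u p.1 p.2) (v p.1 p.2) with hF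
  have huM' : ∀ τ ∈ Ioo s t, ∀ y, ‖u τ y‖ ≤ M := fun τ hτ => huM τ ⟨hτ.1, hτ.2.trans_le htT⟩
  have hvM' : ∀ τ ∈ Ioo s t, ∀ y, ‖v τ y‖ ≤ M := fun τ hτ => hvM τ ⟨hτ.1, hτ.2.trans_le htT⟩
  -- measurability of the integrand on `E3 × ((s,t) × E3)`
  have hsub : Ioo s t ×ˢ (univ : Set (EuclideanSpace ℝ (Fin 3))) ⊆ Ioo s T ×ˢ univ :=
    prod_mono (Ioo_subset_Ioo_right htT) subset_rfl
  have hu' : AEStronglyMeasurable (fun p : ℝ × EuclideanSpace ℝ (Fin 3) => u p.1 p.2) μ :=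
    hu.mono_measure (Measure.restrict_mono hsub le_rfl)
  have hv' : AEStronglyMeasurable (fun p : ℝ × EuclideanSpace ℝ (Fin 3) => v p.1 p.2) μ :=
    hv.mono_measure (Measure.restrict_mono hsub le_rfl)
  have hKm : AEMeasurable (fun q : EuclideanSpace ℝ (Fin 3) × (ℝ × EuclideanSpace ℝ (Fin 3)) => F q.1 q.2)
      ((volume : Measure (EuclideanSpace ℝ (Fin 3))).prod μ) := by
    refine AEMeasurable.oseenKernel_comp ?_ ?_ ?_ ?_
    · exact ((measurable_const.sub measurable_snd.fst).const_mul ν).aemeasurable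
    · exact (measurable_fst.sub measurable_snd.snd).aemeasurable
    · exact (hu'.comp_snd (μ := (volume : Measure (EuclideanSpace ℝ (Fin 3))))).aemeasurable
    · exact (hv'.comp_snd (μ := (volume : Measure (EuclideanSpace ℝ (Fin 3))))).aemeasurable
  have hFm : AEStronglyMeasurable (uncurry fun x p => ⟪F x p, w x⟫) ((volume : Measure (EuclideanSpace ℝ (Fin 3))).prod μ) :=
    (hKm.inner (hw.1.comp_fst (ν := μ)).aemeasurable).aestronglyMeasurable
  -- integrability on the product, by Tonelli and the majorant bound
  obtain ⟨C, hC, hmaj⟩ := exists_lintegral_enorm_oseenKernel_bounded_le (E := EuclideanSpace ℝ (Fin 3))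
  set B : ℝ≥0∞ := ENNReal.ofReal (C * M ^ 2 * ν ^ (-(1 / 2 : ℝ)) * (2 * Real.sqrt (t - s))) with hB
  have hprod : Integrable (uncurry fun x p => ⟪F x p, w x⟫) ((volume : Measure (EuclideanSpace ℝ (Fin 3))).prod μ) := by
    refine ⟨hFm, ?_⟩
    rw [hasFiniteIntegral_iff_enorm, lintegral_prod _ hFm.enorm]
    have hwi : ∫⁻ x, ‖w x‖ₑ ∂(volume : Measure (EuclideanSpace ℝ (Fin 3))) < ∞ := hw.2
    calc ∫⁻ x, ∫⁻ p, ‖uncurry (fun x p => ⟪F x p, w x⟫) (x, p)‖ₑ ∂μ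
        ≤ ∫⁻ x, ∫⁻ p, ‖F x p‖ₑ * ‖w x‖ₑ ∂μ := by
          refine lintegral_mono fun x => lintegral_mono fun p => ?_
          simp only [uncurry_apply_pair]
          rw [← ofReal_norm, ← ofReal_norm, ← ofReal_norm, ← ENNReal.ofReal_mul (norm_nonneg _)]
          refine ENNReal.ofReal_le_ofReal ?_
          rw [Real.norm_eq_abs]
          exact abs_real_inner_le_norm _ _
      _ = ∫⁻ x, (∫⁻ p, ‖F x p‖ₑ ∂μ) * ‖w x‖ₑ := by
          refine lintegral_congr fun x => ?_
          rw [lintegral_mul_const' _ _ enorm_ne_top]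
      _ ≤ ∫⁻ x, B * ‖w x‖ₑ := by
          refine lintegral_mono fun x => ?_
          gcongr
          rw [hμ, volume_restrict_prod_univ_eq_prod]
          exact (lintegral_prod_le _).trans (hmaj hν hst hM huM' hvM' x)
      _ = B * ∫⁻ x, ‖w x‖ₑ := lintegral_const_mul' _ _ ENNReal.ofReal_ne_top
      _ < ∞ := ENNReal.mul_lt_top ENNReal.ofReal_lt_top hwi
  refine ⟨hprod, ?_⟩
  -- the inner product through the integral, then Fubini
  have hinner : ∀ x, ⟪oseenDuhamel ν s u v t x, w x⟫ = ∫ p, ⟪F x p, w x⟫ ∂μ := by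
    intro x
    have hint := integrable_oseenKernel_duhamel_bounded hν hu hv hM huM hvM hst htT x
    rw [oseenDuhamel_eq_integral_prod hν hu hv hM huM hvM hst htT x, real_inner_comm,
      ← integral_inner hint (w x)]
    exact integral_congr_ae (Eventually.of_forall fun p => real_inner_comm _ _)
  calc ∫ x, ⟪oseenDuhamel ν s u v t x, w x⟫ = ∫ x, ∫ p, ⟪F x p, w x⟫ ∂μ :=
        integral_congr_ae (Eventually.of_forall hinner)
    _ = ∫ p, (∫ x, ⟪F x p, w x⟫) ∂μ := integral_integral_swap hprod

/-- **Box form**: for a measurable set `Q` of finite volume and a fixed vector `e`,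
`∫_{x∈Q} ⟪B^ν_s(u,v)(t)(x), e⟫ dx = ∫_{(s,t)×E3} (∫_{x∈Q} ⟪K(ν(t−τ), x−y)[u(τ,y), v(τ,y)], e⟫ dx) d(τ,y)` (the previous identity with the test field `1_Q e`). [folklore] -/
theorem setIntegral_inner_oseenDuhamel_eq {ν s T M : ℝ}
    {u v : ℝ → EuclideanSpace ℝ (Fin 3) → EuclideanSpace ℝ (Fin 3)} (hν : 0 < ν)
    (hu : AEStronglyMeasurable (uncurry u) ((volume : Measure (ℝ × EuclideanSpace ℝ (Fin 3))).restrict (Ioo s T ×ˢ univ)))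
    (hv : AEStronglyMeasurable (uncurry v) ((volume : Measure (ℝ × EuclideanSpace ℝ (Fin 3))).restrict (Ioo s T ×ˢ univ)))
    (hM : 0 ≤ M) (huM : ∀ τ ∈ Ioo s T, ∀ y, ‖u τ y‖ ≤ M) (hvM : ∀ τ ∈ Ioo s T, ∀ y, ‖v τ y‖ ≤ M)
    {t : ℝ} (hst : s < t) (htT : t ≤ T) {Q : Set (EuclideanSpace ℝ (Fin 3))} (hQ : MeasurableSet Q) (hQfin : volume Q ≠ ∞)
    (e : EuclideanSpace ℝ (Fin 3)) :
    ∫ x in Q, ⟪oseenDuhamel ν s u v t x, e⟫ =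
      ∫ p in Ioo s t ×ˢ univ,
        (∫ x in Q, ⟪oseenKernel (ν * (t - p.1)) (x - p.2) (u p.1 p.2) (v p.1 p.2), e⟫)
        ∂(volume : Measure (ℝ × EuclideanSpace ℝ (Fin 3))) := by
  have hw : Integrable (Q.indicator fun _ : EuclideanSpace ℝ (Fin 3) => e) (volume : Measure (EuclideanSpace ℝ (Fin 3))) := by
    rw [integrable_indicator_iff hQ]
    exact Measure.integrableOn_of_bounded (M := ‖e‖) hQfin aestronglyMeasurable_const (ae_of_all _ fun _ => le_rfl)
  have hind : ∀ (f : EuclideanSpace ℝ (Fin 3) → EuclideanSpace ℝ (Fin 3)) (x : EuclideanSpace ℝ (Fin 3)),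
      ⟪f x, Q.indicator (fun _ => e) x⟫ = Q.indicator (fun x => ⟪f x, e⟫) x := fun f x => by
    by_cases hx : x ∈ Q
    · rw [indicator_of_mem hx, indicator_of_mem hx]
    · rw [indicator_of_notMem hx, indicator_of_notMem hx, inner_zero_right]
  obtain ⟨-, heq⟩ := integral_inner_oseenDuhamel_eq_setIntegral_of_integrable hν hu hv hM huM hvM hst htT hw
  have hL : ∫ x, ⟪oseenDuhamel ν s u v t x, Q.indicator (fun _ => e) x⟫ = ∫ x in Q, ⟪oseenDuhamel ν s u v t x, e⟫ := by
    rw [← integral_indicator hQ]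
    exact integral_congr_ae (ae_of_all _ fun x => hind (oseenDuhamel ν s u v t) x)
  have hR : ∀ p : ℝ × EuclideanSpace ℝ (Fin 3),
      ∫ x, ⟪oseenKernel (ν * (t - p.1)) (x - p.2) (u p.1 p.2) (v p.1 p.2), Q.indicator (fun _ => e) x⟫ =
        ∫ x in Q, ⟪oseenKernel (ν * (t - p.1)) (x - p.2) (u p.1 p.2) (v p.1 p.2), e⟫ := fun p => by
    rw [← integral_indicator hQ]
    exact integral_congr_ae (ae_of_all _ fun x =>
      hind (fun x => oseenKernel (ν * (t - p.1)) (x - p.2) (u p.1 p.2) (v p.1 p.2)) x)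
  rw [← hL, heq]
  exact integral_congr_ae (ae_of_all _ fun p => hR p)

/-! ## The stub -/

/-- `⟪w, e₂⟫ = w 2` on `E3`. [folklore] -/
theorem inner_single_two (w : EuclideanSpace ℝ (Fin 3)) : ⟪w, EuclideanSpace.single 2 (1 : ℝ)⟫ = w 2 := by
  rw [EuclideanSpace.inner_single_right]; simp

set_option maxHeartbeats 400000 in
/-- **Stub Z-oseen `stub_zeroModeOseen` of LINE 16 «zero_mode» (VERBATIM body of `ZeroModeOseen`, `flatBox` unfolded).**  See the module docstring. -/
theorem stub_zeroModeOseen :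
    ∀ (C : ℝ) (v : ℝ → EuclideanSpace ℝ (Fin 3) → EuclideanSpace ℝ (Fin 3)),
    Literature.Analysis.FluidPDE.HasTypeITimeDecay C v →
    ContinuousOn (Function.uncurry v) (Set.Iio (0 : ℝ) ×ˢ Set.univ) →
    (∀ s t : ℝ, s < t → t < 0 → ∀ x, v t x =
      Literature.Analysis.UnboundedOperators.heatExtension (v s) (t - s) x -
        Literature.Analysis.FluidPDE.oseenDuhamel 1 s v v t x) →
    ∀ s t : ℝ, s < t → t < 0 → ∀ ε : ℝ, 0 < ε → ∃ L₀ : ℝ, 0 < L₀ ∧ ∀ R H : ℝ, L₀ ≤ R → L₀ ≤ H →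
      |∫ x in {x : EuclideanSpace ℝ (Fin 3) | |x 0| ≤ R ∧ |x 1| ≤ R ∧ 0 ≤ x 2 ∧ x 2 ≤ H}, v t x 2| ≤
        |∫ x in {x : EuclideanSpace ℝ (Fin 3) | |x 0| ≤ R ∧ |x 1| ≤ R ∧ 0 ≤ x 2 ∧ x 2 ≤ H},
            Literature.Analysis.UnboundedOperators.heatExtension (v s) (t - s) x 2| + ε * (4 * R ^ 2 * H) := by
  intro C v hT hcont hmild s t hst ht ε hε
  have hs0 : s < 0 := hst.trans ht
  have hts : 0 < t - s := sub_pos.2 hst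
  have hsq : 0 < Real.sqrt (t - s) := Real.sqrt_pos.2 hts
  -- ## constants (kept opaque: `M₀` mass of the weight, `M` the Type-I bound on `(s,t)`, `A = C₀M²M₀`)
  obtain ⟨C₀, hC₀, hK⟩ := exists_norm_oseenKernel_three_le
  obtain ⟨M₀, hM₀⟩ : ∃ M₀ : ℝ, M₀ = ∫ w : EuclideanSpace ℝ (Fin 3), (1 + ‖w‖ ^ 2) ^ (-(2 : ℝ)) := ⟨_, rfl⟩
  have hM₀pos : 0 < M₀ := by rw [hM₀]; exact integral_weight_one_pos
  obtain ⟨M, hM⟩ : ∃ M : ℝ, M = C / Real.sqrt (-t) := ⟨_, rfl⟩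
  have hM0 : 0 ≤ M := by rw [hM]; exact (norm_nonneg _).trans (hT t ht 0)
  have hC : 0 ≤ C := by
    have h1 := hT t ht 0
    rw [le_div_iff₀ (Real.sqrt_pos.2 (neg_pos.2 ht))] at h1
    exact le_trans (mul_nonneg (norm_nonneg _) (Real.sqrt_nonneg _)) h1
  have hbd : ∀ τ ∈ Ioo s t, ∀ y, ‖v τ y‖ ≤ M := fun τ hτ y => by
    refine (hT τ (hτ.2.trans ht) y).trans ?_
    rw [hM]
    exact div_le_div_of_nonneg_left hC (Real.sqrt_pos.2 (neg_pos.2 ht)) (Real.sqrt_le_sqrt (by linarith [hτ.2]))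
  have hvm : AEStronglyMeasurable (uncurry v)
      ((volume : Measure (ℝ × EuclideanSpace ℝ (Fin 3))).restrict (Ioo s t ×ˢ univ)) :=
    (hcont.mono (prod_mono (fun τ hτ => (hτ.2.trans ht : τ < 0)) subset_rfl)).aestronglyMeasurable
      (measurableSet_Ioo.prod MeasurableSet.univ)
  obtain ⟨A, hA⟩ : ∃ A : ℝ, A = C₀ * M ^ 2 * M₀ := ⟨_, rfl⟩
  have hA0 : 0 ≤ A := by rw [hA]; positivity
  have hA1 : 0 < A + 1 := by linarith
  -- ## the choice of `r` and `L₀`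
  obtain ⟨r, hr⟩ : ∃ r : ℝ, r = 32 * (A + 1) * (t - s) / ε := ⟨_, rfl⟩
  have hr0 : 0 < r := by rw [hr]; positivity
  obtain ⟨L₀, hL₀⟩ : ∃ L₀ : ℝ, L₀ = 4 * r + 64 * (A + 1) * r * Real.sqrt (t - s) / ε := ⟨_, rfl⟩
  have hL₀r : 4 * r ≤ L₀ := by
    rw [hL₀]; linarith [show 0 ≤ 64 * (A + 1) * r * Real.sqrt (t - s) / ε by positivity]
  have hL₀pos : 0 < L₀ := by linarith
  refine ⟨L₀, hL₀pos, fun R H hR hH => ?_⟩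
  have hRr : 4 * r ≤ R := hL₀r.trans hR
  have hHr : 4 * r ≤ H := hL₀r.trans hH
  have hR0 : 0 < R := by linarith
  have hH0 : 0 < H := by linarith
  -- ## the three boxes
  set Q : Set (EuclideanSpace ℝ (Fin 3)) := {x | |x 0| ≤ R ∧ |x 1| ≤ R ∧ 0 ≤ x 2 ∧ x 2 ≤ H} with hQdef
  set Qin : Set (EuclideanSpace ℝ (Fin 3)) := {x | |x 0| ≤ R - r ∧ |x 1| ≤ R - r ∧ 0 + r ≤ x 2 ∧ x 2 ≤ H - r} with hQindef
  set Qcore : Set (EuclideanSpace ℝ (Fin 3)) :=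
    {x | |x 0| ≤ R - r - r ∧ |x 1| ≤ R - r - r ∧ 0 + r + r ≤ x 2 ∧ x 2 ≤ H - r - r} with hQcoredef
  have hQm : MeasurableSet Q := measurableSet_box R 0 H
  have hQinm : MeasurableSet Qin := measurableSet_box (R - r) (0 + r) (H - r)
  have hQcorem : MeasurableSet Qcore := measurableSet_box (R - r - r) (0 + r + r) (H - r - r)
  have hinQ : Qin ⊆ Q := box_shrink_subset hr0.le
  have hcorein : Qcore ⊆ Qin := box_shrink_subset hr0.le
  have hcoreQ : Qcore ⊆ Q := hcorein.trans hinQ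
  have hsep1 : ∀ y ∈ Qin, ∀ x ∈ Qᶜ, r ≤ ‖x - y‖ := fun y hy x hx => le_norm_sub_of_shrink hy hx
  have hsep2 : ∀ x ∈ Qcore, ∀ y ∈ Qinᶜ, r ≤ ‖x - y‖ := fun x hx y hy => le_norm_sub_of_shrink' hx hy
  have hvolQ : volume Q = ENNReal.ofReal (4 * R ^ 2 * H) := by
    rw [hQdef, volume_box 0 H hR0.le, sub_zero]
  have hQfin : volume Q ≠ ∞ := by rw [hvolQ]; exact ENNReal.ofReal_ne_top
  have hvolin : volume Qin ≤ ENNReal.ofReal (4 * R ^ 2 * H) := (measure_mono hinQ).trans hvolQ.le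
  have hvolcore : volume Qcore ≤ ENNReal.ofReal (4 * R ^ 2 * H) := (measure_mono hcoreQ).trans hvolQ.le
  have hvolsh : volume (Q \ Qcore) ≤ ENNReal.ofReal (16 * r * R * (R + H)) :=
    volume_flatBox_diff_core_le hr0.le (by linarith) (by linarith)
  have hvol0 : 0 ≤ 4 * R ^ 2 * H := by positivity
  have hsh0 : 0 ≤ 16 * r * R * (R + H) := by positivity
  -- ## (B) the three-region estimate at each time `τ ∈ (s,t)`
  obtain ⟨a₁, ha₁⟩ : ∃ a₁ : ℝ, a₁ = C₀ * M ^ 2 * M₀ * (4 * (4 * R ^ 2 * H + 4 * R ^ 2 * H) / r) := ⟨_, rfl⟩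
  obtain ⟨b₁, hb₁⟩ : ∃ b₁ : ℝ, b₁ = C₀ * M ^ 2 * M₀ * (16 * r * R * (R + H)) := ⟨_, rfl⟩
  have ha₁0 : 0 ≤ a₁ := by rw [ha₁]; positivity
  have hb₁0 : 0 ≤ b₁ := by rw [hb₁]; positivity
  have hbox : ∀ τ ∈ Ioo s t,
      ∫⁻ y, ‖∫ x in Q, oseenKernel (1 * (t - τ)) (x - y) (v τ y) (v τ y)‖ₑ ≤
        ENNReal.ofReal (a₁ + b₁ * (1 * (t - τ)) ^ (-(1 / 2 : ℝ))) := by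
    intro τ hτ
    have hσ : 0 < 1 * (t - τ) := by rw [one_mul]; exact sub_pos.2 hτ.2
    have h := lintegral_enorm_setIntegral_oseenKernel_le hC₀.le hK hσ hr0 hM0
      (hbd τ hτ) (hbd τ hτ) hQm hQinm hQcorem hcoreQ hsep1 hsep2 hvol0 hvol0 hsh0 hvolin hvolcore hvolsh
    rw [← hM₀] at h
    refine h.trans (le_of_eq ?_)
    congr 1
    rw [ha₁, hb₁]; ring
  -- ## (Z) Fubini + (T) time: the box integral of the Duhamel term
  obtain ⟨e₂, he₂⟩ : ∃ e₂ : EuclideanSpace ℝ (Fin 3), e₂ = EuclideanSpace.single 2 (1 : ℝ) := ⟨_, rfl⟩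
  have hinner : ∀ w : EuclideanSpace ℝ (Fin 3), ⟪w, e₂⟫ = w 2 := fun w => by rw [he₂]; exact inner_single_two w
  obtain ⟨TB, hTB⟩ : ∃ TB : ℝ, TB = ∫ x in Q, ⟪oseenDuhamel 1 s v v t x, e₂⟫ := ⟨_, rfl⟩
  have hTB_le : |TB| ≤ a₁ * (t - s) + b₁ * (2 * Real.sqrt (t - s)) := by
    have hfub := setIntegral_inner_oseenDuhamel_eq (ν := 1) (T := t) one_pos hvm hvm hM0 hbd hbd hst le_rfl hQm hQfin e₂
    obtain ⟨g, hg⟩ : ∃ g : ℝ × EuclideanSpace ℝ (Fin 3) → ℝ, g = fun p =>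
        ∫ x in Q, ⟪oseenKernel (1 * (t - p.1)) (x - p.2) (v p.1 p.2) (v p.1 p.2), e₂⟫ := ⟨_, rfl⟩
    -- pointwise: `|g p| ≤ ‖∫_{x∈Q} K‖`
    have hpt : ∀ p ∈ Ioo s t ×ˢ (univ : Set (EuclideanSpace ℝ (Fin 3))),
        ‖g p‖ₑ ≤ ‖∫ x in Q, oseenKernel (1 * (t - p.1)) (x - p.2) (v p.1 p.2) (v p.1 p.2)‖ₑ := by
      intro p hp
      rw [mem_prod] at hp
      have hσ : 0 < 1 * (t - p.1) := by rw [one_mul]; exact sub_pos.2 hp.1.2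
      have hint : IntegrableOn (fun x => oseenKernel (1 * (t - p.1)) (x - p.2) (v p.1 p.2) (v p.1 p.2)) Q := by
        obtain ⟨C', -, h⟩ := exists_lintegral_enorm_oseenKernel_le (E := EuclideanSpace ℝ (Fin 3))
        exact ((h hσ (v p.1 p.2) (v p.1 p.2)).1.comp_sub_right p.2).integrableOn
      have hgp : g p = (∫ x in Q, oseenKernel (1 * (t - p.1)) (x - p.2) (v p.1 p.2) (v p.1 p.2)) 2 := by
        rw [← hinner (∫ x in Q, oseenKernel (1 * (t - p.1)) (x - p.2) (v p.1 p.2) (v p.1 p.2)), real_inner_comm,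
          ← integral_inner hint e₂, hg]
        exact integral_congr_ae (ae_of_all _ fun x => real_inner_comm _ _)
      rw [hgp, ← ofReal_norm, ← ofReal_norm, Real.norm_eq_abs]
      refine ENNReal.ofReal_le_ofReal ?_
      have h := PiLp.norm_apply_le (∫ x in Q, oseenKernel (1 * (t - p.1)) (x - p.2) (v p.1 p.2) (v p.1 p.2)) 2
      rwa [Real.norm_eq_abs] at h
    have htime : ∫⁻ τ in Ioo s t, ENNReal.ofReal (a₁ + b₁ * (1 * (t - τ)) ^ (-(1 / 2 : ℝ))) =
        ENNReal.ofReal (a₁ * (t - s) + b₁ * (2 * Real.sqrt (t - s))) := by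
      have h1 : ∫⁻ τ in Ioo s t, ENNReal.ofReal (a₁ + b₁ * (1 * (t - τ)) ^ (-(1 / 2 : ℝ))) =
          ∫⁻ τ in Ioo s t, (ENNReal.ofReal a₁ + ENNReal.ofReal b₁ * ENNReal.ofReal ((t - τ) ^ (-(1 / 2 : ℝ)))) := by
        refine setLIntegral_congr_fun measurableSet_Ioo fun τ hτ => ?_
        rw [one_mul, ← ENNReal.ofReal_mul hb₁0,
          ← ENNReal.ofReal_add ha₁0 (mul_nonneg hb₁0 (Real.rpow_nonneg (sub_pos.2 hτ.2).le _))]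
      rw [h1, lintegral_add_left measurable_const, setLIntegral_const, Real.volume_Ioo,
        lintegral_const_mul' _ _ ENNReal.ofReal_ne_top, setLIntegral_Ioo_sub_rpow_neg_half_of_lt hst,
        ← ENNReal.ofReal_mul ha₁0, ← ENNReal.ofReal_mul hb₁0,
        ← ENNReal.ofReal_add (mul_nonneg ha₁0 hts.le) (mul_nonneg hb₁0 (by positivity))]
    have hrhs0 : 0 ≤ a₁ * (t - s) + b₁ * (2 * Real.sqrt (t - s)) :=
      add_nonneg (mul_nonneg ha₁0 hts.le) (mul_nonneg hb₁0 (by positivity))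
    have hchain : ENNReal.ofReal |TB| ≤ ENNReal.ofReal (a₁ * (t - s) + b₁ * (2 * Real.sqrt (t - s))) := by
      calc ENNReal.ofReal |TB| = ‖TB‖ₑ := by rw [← Real.norm_eq_abs, ofReal_norm]
        _ = ‖∫ p in Ioo s t ×ˢ univ, g p ∂(volume : Measure (ℝ × EuclideanSpace ℝ (Fin 3)))‖ₑ := by rw [hTB, hfub, hg]
        _ ≤ ∫⁻ p in Ioo s t ×ˢ univ, ‖g p‖ₑ ∂(volume : Measure (ℝ × EuclideanSpace ℝ (Fin 3))) :=
            enorm_integral_le_lintegral_enorm _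
        _ ≤ ∫⁻ p in Ioo s t ×ˢ univ, ‖∫ x in Q, oseenKernel (1 * (t - p.1)) (x - p.2) (v p.1 p.2) (v p.1 p.2)‖ₑ
              ∂(volume : Measure (ℝ × EuclideanSpace ℝ (Fin 3))) :=
            setLIntegral_mono' (measurableSet_Ioo.prod MeasurableSet.univ) hpt
        _ ≤ ∫⁻ τ in Ioo s t, ∫⁻ y, ‖∫ x in Q, oseenKernel (1 * (t - τ)) (x - y) (v τ y) (v τ y)‖ₑ := by
            rw [volume_restrict_prod_univ_eq_prod]
            exact lintegral_prod_le _
        _ ≤ ∫⁻ τ in Ioo s t, ENNReal.ofReal (a₁ + b₁ * (1 * (t - τ)) ^ (-(1 / 2 : ℝ))) :=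
            setLIntegral_mono' measurableSet_Ioo fun τ hτ => hbox τ hτ
        _ = ENNReal.ofReal (a₁ * (t - s) + b₁ * (2 * Real.sqrt (t - s))) := htime
    exact (ENNReal.ofReal_le_ofReal_iff hrhs0).1 hchain
  -- ## (T') each of the two terms is `≤ εR²H`
  have hTB_small : |TB| ≤ ε / 2 * (4 * R ^ 2 * H) := by
    have hRH : 0 < R ^ 2 * H := by positivity
    -- first term: `a₁(t−s) = A·32R²H(t−s)/r = εR²H·A/(A+1) ≤ εR²H`
    have h1 : a₁ * (t - s) ≤ ε * (R ^ 2 * H) := by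
      have heq : a₁ * (t - s) = ε * (R ^ 2 * H) * (A / (A + 1)) := by
        rw [ha₁, hr, ← hA]; field_simp; ring
      rw [heq]
      have hfrac : A / (A + 1) ≤ 1 := (div_le_one hA1).2 (by linarith)
      calc ε * (R ^ 2 * H) * (A / (A + 1)) ≤ ε * (R ^ 2 * H) * 1 :=
            mul_le_mul_of_nonneg_left hfrac (by positivity)
        _ = ε * (R ^ 2 * H) := mul_one _
    -- second term: `2b₁√(t−s) = 32·A·r·R(R+H)√(t−s)` and `64 A r √(t−s) ≤ ε L₀ ≤ ε R, ε H`
    have h2 : b₁ * (2 * Real.sqrt (t - s)) ≤ ε * (R ^ 2 * H) := by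
      have hkey : 64 * A * r * Real.sqrt (t - s) ≤ ε * L₀ := by
        have : ε * L₀ = 4 * r * ε + 64 * (A + 1) * r * Real.sqrt (t - s) := by
          rw [hL₀]; field_simp
        rw [this]
        nlinarith [mul_nonneg hr0.le hsq.le, mul_pos hr0 hε]
      have hkR : 64 * A * r * Real.sqrt (t - s) ≤ ε * R := hkey.trans (mul_le_mul_of_nonneg_left hR hε.le)
      have hkH : 64 * A * r * Real.sqrt (t - s) ≤ ε * H := hkey.trans (mul_le_mul_of_nonneg_left hH hε.le)
      have heq : b₁ * (2 * Real.sqrt (t - s)) =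
          (64 * A * r * Real.sqrt (t - s)) * (R ^ 2 / 2) + (64 * A * r * Real.sqrt (t - s)) * (R * H / 2) := by
        rw [hb₁, ← hA]; ring
      rw [heq]
      have i1 : (64 * A * r * Real.sqrt (t - s)) * (R ^ 2 / 2) ≤ (ε * H) * (R ^ 2 / 2) :=
        mul_le_mul_of_nonneg_right hkH (by positivity)
      have i2 : (64 * A * r * Real.sqrt (t - s)) * (R * H / 2) ≤ (ε * R) * (R * H / 2) :=
        mul_le_mul_of_nonneg_right hkR (by positivity)
      have i3 : (ε * H) * (R ^ 2 / 2) + (ε * R) * (R * H / 2) = ε * (R ^ 2 * H) := by ring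
      linarith [i1, i2, i3]
    have : ε / 2 * (4 * R ^ 2 * H) = ε * (R ^ 2 * H) + ε * (R ^ 2 * H) := by ring
    linarith [h1, h2, hTB_le]
  -- ## the mild identity on the box: `∫_Q v₂(t) = ∫_Q (heat)₂ − T_B`
  have hvt : Continuous (v t) :=
    hcont.comp_continuous (continuous_const.prodMk continuous_id) fun x => ⟨ht, mem_univ _⟩
  have hvs : Continuous (v s) :=
    hcont.comp_continuous (continuous_const.prodMk continuous_id) fun x => ⟨hs0, mem_univ _⟩
  have hIv : IntegrableOn (v t) Q :=
    Measure.integrableOn_of_bounded (M := C / Real.sqrt (-t)) hQfin hvt.aestronglyMeasurable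
      (ae_of_all _ fun x => hT t ht x)
  have hIh : IntegrableOn (fun x => heatExtension (v s) (t - s) x) Q :=
    Measure.integrableOn_of_bounded (M := C / Real.sqrt (-s)) hQfin
      (aestronglyMeasurable_heatExtension_of_aestronglyMeasurable hvs.aestronglyMeasurable (t - s))
      (ae_of_all _ fun x => norm_heatExtension_le_of_bound (fun z => hT s hs0 z) hts x)
  have hIB : IntegrableOn (fun x => oseenDuhamel 1 s v v t x) Q := by
    refine (hIh.sub hIv).congr (ae_of_all _ fun x => ?_)
    have h := hmild s t hst ht x
    simp only [Pi.sub_apply]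
    rw [h]; abel
  have hsplit : ∫ x in Q, ⟪v t x, e₂⟫ = (∫ x in Q, ⟪heatExtension (v s) (t - s) x, e₂⟫) - TB := by
    rw [hTB, ← integral_sub (hIh.inner_const e₂) (hIB.inner_const e₂)]
    refine integral_congr_ae (ae_of_all _ fun x => ?_)
    simp only
    rw [hmild s t hst ht x, inner_sub_left]
  -- ## conclusion
  have hcomp1 : ∫ x in Q, v t x 2 = ∫ x in Q, ⟪v t x, e₂⟫ :=
    integral_congr_ae (ae_of_all _ fun x => (hinner (v t x)).symm)
  have hcomp2 : ∫ x in Q, heatExtension (v s) (t - s) x 2 = ∫ x in Q, ⟪heatExtension (v s) (t - s) x, e₂⟫ :=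
    integral_congr_ae (ae_of_all _ fun x => (hinner _).symm)
  rw [hcomp1, hcomp2, hsplit]
  have hε4 : ε / 2 * (4 * R ^ 2 * H) ≤ ε * (4 * R ^ 2 * H) := by nlinarith [hvol0, hε]
  calc |(∫ x in Q, ⟪heatExtension (v s) (t - s) x, e₂⟫) - TB|
      ≤ |∫ x in Q, ⟪heatExtension (v s) (t - s) x, e₂⟫| + |TB| := abs_sub _ _
    _ ≤ |∫ x in Q, ⟪heatExtension (v s) (t - s) x, e₂⟫| + ε * (4 * R ^ 2 * H) := by linarith [hTB_small, hε4]

end Summit.NavierStokesRegularity.NavierStokesRegularity.Theorems.PoloidalWindowDoorPoloidalWindowRigidityZeroModeOseen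

end
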